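import Literature.Barriers.ValiantsHypothesis.BILPS19Cor42VerifierSemantics
import Literature.Barriers.ValiantsHypothesis.BILPS19HMinRank1ToHQuadProofs
import Literature.Computability.AlgebraicComplexity.KIReductionBricks
import Literature.Computability.Complexity.CodeFPBudgets
import HarnessLib

/-!
# Bläser–Ikenmeyer–Lysikov–Pandey–Schreyer 2019, Cor 42: the `∃BPP` verifier's machine — the two
# identity-test instances are written in polynomial time

Sibling of `BILPS19Cor42VerifierSemantics.lean` (the circuits `chartCircuit`, `evalCircuit` of the
verifier of BILPS Thm 40 / Cor 42, arXiv:1911.02534 p0035:L1–L20). This file is the STRING level: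
on the code of an `HMinRank1` instance `x = (n, k, entries, r)` (`tensorInstEncoding`) paired with a
guessed gate list `y` (read by the tree's total reader `KIReduction.readBlock`), polynomial-time
string functions write the code words (`KIReduction.circuitWord`) of the chart-test circuit and of
the evaluation circuit, in the typed `CodeFP` algebra (`CodeFP.lean`, `CodeFPArith.lean`,
`CodeFPBudgets.lean`) on the decoder template of `BILPS19HMinRank1ToHQuadProofs.lean`
(`BILPS19Thm34.decT`). Every loop runs under a unary budget read off the entry list (the guard
`|entries| = k n²`, `r = 1`, `1 ≤ n`, `1 ≤ k` makes `n, k ≤ |entries|`).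

* §1 `ℕ`-indexed circuit syntax (`Operand ℤ ℕ`, `Gate ℤ ℕ`) with the encoders `opE`, `gateE`,
  `circE` and the bridge `encodeArithCircuit_eq_circE` to the tree's circuit code (the code of
  `var i` is `00 · bin i`, independent of the number of variables);
* §2 `CodeFP` constructors of operands, gates, and KI uses (`KIReduction.blockCodeF`);
* §3 the writers `chartWordC`, `evalWordC` on (instance, witness) under the budget, equal under the
  guard to the code words of `chartCircuit` / `evalCircuit` (`chartWordC_eq`, `evalWordC_eq`), and
  the guard / easy-case tests; §4 the string functions `chartWordFn`, `evalWordFn ∈ FP` on the full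
  input word `⟨w, y⟩`.

Theorem-only file with plumbing `def`s; no statement of the barrier file is touched, no new fact.
HONEST FRAMING (val-lit): Boolean plumbing of a printed `∃BPP` verifier; `VP ≠ VNP` is NOT proved.

## References

* [BlaserIkenmeyerLysikovPandeySchreyer2019] arXiv:1911.02534, §8.3 Thm. 40 (proof), Cor. 42.
* [KabanetsImpagliazzo2003] STOC 2003, proof of Cor. 12 (p. 358) (writing guessed circuits).
* [AroraBarak2009] S. Arora, B. Barak, *Computational Complexity: A Modern Approach*, CUP 2009,
  §0.1 (codes), §1.3 (polynomial time: composition, bounded loops).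
-/

noncomputable section

namespace Literature.Barriers.ValiantsHypothesis

namespace BILPS2019Cor42

open Literature.Computability.AlgebraicComplexity Literature.Computability.Complexity ArithCircuit KIReduction
open _root_.Computability CodeFP Brick CanonCode BILPS19Thm34
open scoped Literature.Computability.Complexity.Notation

/-! ### §1. `ℕ`-indexed circuit syntax and its code -/

section Syntax

/-- Code of an operand with `ℕ`-indexed variables: `var i ↦ 00·bin i`, `const c ↦ 01·sm c`,
`gate j ↦ 1·bin j` (the tree's `operandEncoding`, whose variable code does not depend on the number
of variables). [cite: AroraBarak2009, §0.1] -/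
def opE : Operand ℤ ℕ → List Bool
  | .var i => false :: false :: natE i
  | .const c => false :: true :: smE c
  | .gate j => true :: natE j

/-- Code of a gate with `ℕ`-indexed variables (the tree's `gateEncoding`). [cite: AroraBarak2009, §0.1] -/
def gateE : Gate ℤ ℕ → List Bool
  | .sum args => false :: listE (pairE smE opE) args
  | .prod args => true :: listE opE args

/-- Code of a circuit body `(gates, output)` (the tree's `arithCircuitEncoding`). [cite: AroraBarak2009, §0.1] -/
def circE : List (Gate ℤ ℕ) × Operand ℤ ℕ → List Bool := pairE (listE gateE) opE

/-- Code word of an identity-test instance `(M, gates, output)` (the tree's `circuitWord`).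
[cite: KabanetsImpagliazzo2003, §2 (p. 357)] -/
def wordE : ℕ × (List (Gate ℤ ℕ) × Operand ℤ ℕ) → List Bool := pairE natE circE

/-- Forgetting the variable bound of a circuit: `var ⟨i, _⟩ ↦ var i`. [folklore] -/
def forgetFin {M : ℕ} (C : ArithCircuit ℤ (Fin M)) : List (Gate ℤ ℕ) × Operand ℤ ℕ :=
  (C.gates.map (Gate.rename Fin.val), C.output.rename Fin.val)

/-- The operand code forgets the variable bound. [cite: AroraBarak2009, §0.1] -/
theorem operandEncoding_eq_opE {M : ℕ} (u : Operand ℤ (Fin M)) :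
    (operandEncoding M).encode u = opE (u.rename Fin.val) := by
  cases u <;> rfl

/-- `listE` of a mapped list is `listE` of the composite encoder. [folklore] -/
private theorem listE_map {α β : Type} (e : β → List Bool) (f : α → β) (l : List α) :
    listE e (l.map f) = listE (e ∘ f) l := by
  simp [listE, rawE, List.map_map]

/-- The gate code forgets the variable bound. [cite: AroraBarak2009, §0.1] -/
theorem gateEncoding_eq_gateE {M : ℕ} (g : Gate ℤ (Fin M)) :
    (gateEncoding M).encode g = gateE (g.rename Fin.val) := by
  cases g with
  | sum args =>
    simp only [gateEncoding, gateE, Gate.rename, List.cons.injEq, true_and]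
    rw [listE_eq, pairE_eq, listE_map]
    congr 1
    funext a
    simp [pairE, operandEncoding_eq_opE, smE]
  | prod args =>
    simp only [gateEncoding, gateE, Gate.rename, List.cons.injEq, true_and]
    rw [listE_eq, listE_map]
    congr 1
    funext u; exact operandEncoding_eq_opE u

/-- **The circuit code forgets the variable bound**: `encodeArithCircuit M C = circE (forgetFin C)`. [cite: AroraBarak2009, §0.1] -/
theorem encodeArithCircuit_eq_circE {M : ℕ} (C : ArithCircuit ℤ (Fin M)) :
    encodeArithCircuit M C = circE (forgetFin C) := by
  rw [encodeArithCircuit_eq, circE, pairE_apply, forgetFin]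
  simp only
  have hg : C.gates.map (gateCode M) = (C.gates.map (Gate.rename Fin.val)).map gateE := by
    rw [List.map_map]
    exact List.map_congr_left fun g _ => gateEncoding_eq_gateE g
  rw [listE, unE_eq_ones, List.length_map, rawE, ← hg, opCode, operandEncoding_eq_opE]

/-- **The code word forgets the variable bound.** [cite: KabanetsImpagliazzo2003, §2 (p. 357)] -/
theorem circuitWord_eq_wordE {M : ℕ} (C : ArithCircuit ℤ (Fin M)) :
    circuitWord M C = wordE (M, forgetFin C) := by
  rw [circuitWord, encodeArithCircuit_eq_circE]; rfl

/-- KI's `gateCode` of a realised guessed gate is its `ℕ`-indexed code (block gates contain no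
variables). [cite: KabanetsImpagliazzo2003, proof of Cor. 12 (p. 358)] -/
theorem gateCode_toGate (N base : ℕ) (g : KGate) :
    gateCode N (g.toGate base) = gateE (g.toGate base : Gate ℤ ℕ) := by
  rw [gateCode, gateEncoding_eq_gateE]
  congr 1
  obtain ⟨kd, a, b⟩ := g
  have hop : ∀ u : KOp, (u.toOperand base : Operand ℤ (Fin N)).rename Fin.val = (u.toOperand base : Operand ℤ ℕ) :=
    fun u => by cases u <;> rfl
  cases kd <;> simp [KGate.toGate, Gate.rename, hop]

end Syntax

/-! ### §2. `CodeFP` constructors of operands, gates, uses -/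

section Constructors

/-- `i ↦ var i` on codes. [cite: AroraBarak2009, §0.1] -/
theorem opVarFP : CodeFP natE opE Operand.var :=
  of_fn (List.cons false ∘ List.cons false) (comp_mem_FP (cons_mem_FP false) (cons_mem_FP false)) fun _ => rfl

/-- `c ↦ const c` on codes. [cite: AroraBarak2009, §0.1] -/
theorem opConstFP : CodeFP smE opE Operand.const :=
  of_fn (List.cons false ∘ List.cons true) (comp_mem_FP (cons_mem_FP false) (cons_mem_FP true)) fun _ => rfl

/-- `j ↦ gate j` on codes. [cite: AroraBarak2009, §0.1] -/
theorem opGateFP : CodeFP natE opE Operand.gate :=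
  of_fn (List.cons true) (cons_mem_FP true) fun _ => rfl

/-- The `ℕ`-indexed twin of `varOp`: `var i` if `i < M`, else `const 0`. [cite: Burgisser2000, Def. 2.1] -/
def varOpN (M i : ℕ) : Operand ℤ ℕ := if i < M then .var i else .const 0

/-- `varOp` forgets to `varOpN`. [cite: Burgisser2000, Def. 2.1] -/
theorem rename_varOp (M i : ℕ) : (varOp M i).rename Fin.val = varOpN M i := by
  unfold varOp varOpN
  by_cases h : i < M
  · rw [dif_pos h, if_pos h]; rfl
  · rw [dif_neg h, if_neg h]; rfl

/-- `(M, i) ↦ varOpN M i` on codes. [cite: AroraBarak2009, §1.3] -/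
theorem varOpNFP : CodeFP (pairE natE natE) opE (fun p => varOpN p.1 p.2) :=
  ((natLt.comp ((snd _ _).pair (fst _ _))).ite (opVarFP.comp (snd _ _)) (const _ (.const 0))).congr
    fun p => by simp only [varOpN, decide_eq_true_eq]

/-- `args ↦ prod args` on codes. [cite: AroraBarak2009, §0.1] -/
theorem gateProdFP : CodeFP (rawE opE) gateE Gate.prod :=
  (of_fn (List.cons true) (cons_mem_FP true) (fun _ => rfl) : CodeFP (listE opE) gateE Gate.prod).comp
    (listOfRaw opE)

/-- `args ↦ sum args` on codes. [cite: AroraBarak2009, §0.1] -/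
theorem gateSumFP : CodeFP (rawE (pairE smE opE)) gateE Gate.sum :=
  (of_fn (List.cons false) (cons_mem_FP false) (fun _ => rfl) :
    CodeFP (listE (pairE smE opE)) gateE Gate.sum).comp (listOfRaw _)

/-- `(u, v) ↦ prod [u, v]` on codes. [cite: AroraBarak2009, §0.1] -/
theorem gateProd₂FP : CodeFP (pairE opE opE) gateE (fun p => Gate.prod [p.1, p.2]) :=
  gateProdFP.comp ((rawCons opE).comp ((fst _ _).pair ((rawSingleton opE).comp (snd _ _))))

/-- `u ↦ sum [(1, u)]` on codes. [cite: AroraBarak2009, §0.1] -/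
theorem gateCopyFP : CodeFP opE gateE (fun u => Gate.sum [((1 : ℤ), u)]) :=
  gateSumFP.comp ((rawSingleton _).comp (((const opE (1 : ℤ)).pair (CodeFP.id opE)).congr fun _ => rfl))

/-- The code of a pair `(base + 1, witness)`, as read by KI's block writer. [folklore] -/
def useArgE : ℕ × List Bool → List Bool := fun p => boolPair (natE (p.1 + 1)) p.2

/-- **The realised guessed gates of a witness string behind offset `base + 1`, on codes** (KI's
`blockCodeF`). [cite: KabanetsImpagliazzo2003, proof of Cor. 12 (p. 358)] -/
theorem useBlockFP : CodeFP useArgE (rawE gateE)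
    (fun p => ((readBlock p.2).map (KGate.toGate (p.1 + 1)) : List (Gate ℤ ℕ))) :=
  of_fn blockCodeF blockCodeF_mem_FP fun p => by
    rw [useArgE, blockCodeF_apply 0, rawE, List.map_map, List.map_map]
    exact congrArg encList (List.map_congr_left fun g _ => gateCode_toGate 0 (p.1 + 1) g)

variable {S : Type} {eS : S → List Bool}

/-- The realised guessed gates with a computed offset and witness. [cite: KabanetsImpagliazzo2003, proof of Cor. 12 (p. 358)] -/
theorem useBlockFP' {base : S → ℕ} {wit : S → List Bool} (hb : CodeFP eS natE base)
    (hw : CodeFP eS strE wit) :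
    CodeFP eS (rawE gateE) (fun s => ((readBlock (wit s)).map (KGate.toGate (base s + 1)) : List (Gate ℤ ℕ))) :=
  have h : CodeFP eS useArgE (fun s => (base s, wit s)) :=
    ((natAdd.comp (hb.pair (const _ 1))).pair hw).recodeOut (g' := fun s => (base s, wit s)) fun _ => rfl
  useBlockFP.comp h

/-- **A use behind gate references on codes**: guard, `N` copies `1 • gate (refs i)`, the block. [cite: KabanetsImpagliazzo2003, proof of Cor. 12 (p. 358)] -/
theorem useGatesRefFP {base : S → ℕ} {refs : S × ℕ → ℕ} {rng : S → List ℕ} {wit : S → List Bool}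
    (hb : CodeFP eS natE base) (hrefs : CodeFP (pairE eS natE) natE refs) (hrng : CodeFP eS (rawE natE) rng)
    (hw : CodeFP eS strE wit) :
    CodeFP eS (rawE gateE) (fun s => (Gate.sum [] :: ((rng s).map (fun i => Gate.sum [((1 : ℤ), .gate (refs (s, i)))]) ++
      (readBlock (wit s)).map (KGate.toGate (base s + 1))) : List (Gate ℤ ℕ))) :=
  (rawCons gateE).comp ((const _ (Gate.sum [])).pair ((rawAppend gateE).comp
    (((CodeFP.map (gateCopyFP.comp (opGateFP.comp hrefs))).comp ((CodeFP.id eS).pair hrng)).pair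
      (useBlockFP' hb hw))))

end Constructors

/-! ### §3. The `ℕ`-indexed twins of the verifier's circuits -/

section Twins

variable (k n : ℕ)

/-- Twin of `prodUV`. [cite: BlaserIkenmeyerLysikovPandeySchreyer2019, Thm. 40 (proof)] -/
def prodUVN (i : ℕ) : Gate ℤ ℕ :=
  .prod [varOpN (nVar k n) (uIdx k n ((i / n) % n)), varOpN (nVar k n) (vIdx k n (i % n))]

/-- Twin of `prodXS`. [cite: BlaserIkenmeyerLysikovPandeySchreyer2019, Thm. 40 (proof)] -/
def prodXSN (i a' : ℕ) : Gate ℤ ℕ :=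
  .prod [varOpN (nVar k n) (xIdx k n a'), varOpN (nVar k n) (a' * n ^ 2 + ((i / n) % n) * n + i % n)]

/-- Twin of `coordGate`. [cite: BlaserIkenmeyerLysikovPandeySchreyer2019, Thm. 40 (proof)] -/
def coordGateN (a₀ i p : ℕ) : Gate ℤ ℕ :=
  if i / n ^ 2 = a₀ then
    .sum (((1 : ℤ), .gate p) :: (List.range k).map fun a' => (if a' = a₀ then (0 : ℤ) else -1, .gate (p + 1 + a')))
  else .sum [((1 : ℤ), varOpN (nVar k n) i)]

/-- Twin of `coordBlock`. [cite: BlaserIkenmeyerLysikovPandeySchreyer2019, Thm. 40 (proof)] -/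
def coordBlockN (a₀ i p : ℕ) : List (Gate ℤ ℕ) :=
  prodUVN k n i :: ((List.range k).map (prodXSN k n i) ++ [coordGateN k n a₀ i p])

/-- Twin of `coords`. [cite: BlaserIkenmeyerLysikovPandeySchreyer2019, Thm. 40 (proof)] -/
def coordsN (a₀ base m : ℕ) : List (Gate ℤ ℕ) :=
  (List.range m).flatMap fun i => coordBlockN k n a₀ i (base + i * (k + 2))

/-- Twin of `chartBlock`. [cite: BlaserIkenmeyerLysikovPandeySchreyer2019, Thm. 40 (proof)] -/
def chartBlockN (B : KBlock) (a₀ base : ℕ) : List (Gate ℤ ℕ) :=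
  coordsN k n a₀ base (nIn k n) ++
    useGatesRef (base + nIn k n * (k + 2)) (coordRef k base) (nIn k n) B ++
    [.prod [varOpN (nVar k n) (yIdx k n a₀), .gate (base + nIn k n * (k + 2) + useOut (nIn k n) B)]]

/-- Twin of `charts`. [cite: BlaserIkenmeyerLysikovPandeySchreyer2019, Thm. 40 (proof)] -/
def chartsN (B : KBlock) (m : ℕ) : List (Gate ℤ ℕ) :=
  (List.range m).flatMap fun a₀ => chartBlockN k n B a₀ (a₀ * blockLen k n B)

/-- Twin of `finalGate`. [cite: BlaserIkenmeyerLysikovPandeySchreyer2019, Thm. 40 (proof)] -/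
def finalGateN (B : KBlock) : Gate ℤ ℕ :=
  .sum ((List.range k).map fun a₀ => ((1 : ℤ), .gate (a₀ * blockLen k n B + (blockLen k n B - 1))))

/-- Twin of the body of `chartCircuit`: gates and output. [cite: BlaserIkenmeyerLysikovPandeySchreyer2019, Thm. 40 (proof)] -/
def chartBodyN (B : KBlock) : List (Gate ℤ ℕ) × Operand ℤ ℕ :=
  (chartsN k n B k ++ [finalGateN k n B] ++ List.replicate (nVar k n) (Gate.sum []),
    .gate (k * blockLen k n B))

variable {k n}

/-- Gate references have no variables. [folklore] -/
private theorem rename_gateOp {M : ℕ} (j : ℕ) :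
    (Operand.gate j : Operand ℤ (Fin M)).rename Fin.val = (Operand.gate j : Operand ℤ ℕ) := rfl

/-- The empty sum has no variables. [folklore] -/
private theorem rename_sumNil {M : ℕ} :
    (Gate.sum [] : Gate ℤ (Fin M)).rename Fin.val = (Gate.sum [] : Gate ℤ ℕ) := rfl

/-- Renaming a product of two `varOp`s. [folklore] -/
private theorem rename_prod₂ {M : ℕ} (i j : ℕ) :
    (Gate.prod [varOp M i, varOp M j] : Gate ℤ (Fin M)).rename Fin.val = .prod [varOpN M i, varOpN M j] := by
  simp [Gate.rename, rename_varOp]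

/-- Realised guessed gates have no variables. [folklore] -/
private theorem rename_toGate {M : ℕ} (base : ℕ) (g : KGate) :
    (g.toGate base : Gate ℤ (Fin M)).rename Fin.val = (g.toGate base : Gate ℤ ℕ) := by
  obtain ⟨kd, a, b⟩ := g
  have hop : ∀ u : KOp, (u.toOperand base : Operand ℤ (Fin M)).rename Fin.val = (u.toOperand base : Operand ℤ ℕ) :=
    fun u => by cases u <;> rfl
  cases kd <;> simp [KGate.toGate, Gate.rename, hop]

/-- Renaming a use behind gate references (no variables). [folklore] -/
private theorem map_rename_useGatesRef {M : ℕ} (base : ℕ) (refs : ℕ → ℕ) (N : ℕ) (B : KBlock) :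
    (useGatesRef base refs N B : List (Gate ℤ (Fin M))).map (Gate.rename Fin.val) = useGatesRef base refs N B := by
  simp only [useGatesRef, List.map_cons, List.map_append, List.map_map, Function.comp_def, rename_toGate]
  rfl

/-- The coordinate block forgets to its twin. [folklore] -/
private theorem map_rename_coordBlock (a₀ i p : ℕ) :
    (coordBlock k n a₀ i p).map (Gate.rename Fin.val) = coordBlockN k n a₀ i p := by
  simp only [coordBlock, coordBlockN, List.map_cons, List.map_append, List.map_map, Function.comp_def,
    prodUV, prodUVN, prodXS, rename_prod₂]
  congr 2
  unfold coordGate coordGateN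
  split_ifs
  · simp [Gate.rename, Operand.rename, List.map_map, Function.comp_def]
  · simp [Gate.rename, rename_varOp]

/-- The coordinates forget to their twin. [folklore] -/
private theorem map_rename_coords (a₀ base m : ℕ) :
    (coords k n a₀ base m).map (Gate.rename Fin.val) = coordsN k n a₀ base m := by
  simp only [coords, coordsN, List.map_flatMap, map_rename_coordBlock]

/-- A chart block forgets to its twin. [folklore] -/
private theorem map_rename_chartBlock (B : KBlock) (a₀ base : ℕ) :
    (chartBlock k n B a₀ base).map (Gate.rename Fin.val) = chartBlockN k n B a₀ base := by
  simp only [chartBlock, chartBlockN, List.map_append, map_rename_coords, map_rename_useGatesRef,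
    List.map_cons, List.map_nil, Gate.rename, rename_varOp, rename_gateOp]

/-- The final gate has no variables. [folklore] -/
private theorem rename_finalGate (B : KBlock) :
    (finalGate k n B).rename Fin.val = finalGateN k n B := by
  simp [finalGate, finalGateN, Gate.rename, Operand.rename, List.map_map, Function.comp_def]

/-- **The chart-test circuit forgets to its twin.** [cite: BlaserIkenmeyerLysikovPandeySchreyer2019, Thm. 40 (proof)] -/
theorem forgetFin_chartCircuit (k n : ℕ) (B : KBlock) : forgetFin (chartCircuit k n B) = chartBodyN k n B := by
  simp only [forgetFin, chartCircuit, chartBodyN, charts, chartsN, ballast, List.map_append, List.map_flatMap,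
    map_rename_chartBlock, List.map_cons, List.map_nil, List.map_replicate, rename_finalGate, rename_sumNil,
    rename_gateOp]

/-- Twin of the body of `evalCircuit`. [cite: BlaserIkenmeyerLysikovPandeySchreyer2019, Thm. 40 (proof)] -/
def evalBodyN (N : ℕ) (c : ℕ → ℤ) (B : KBlock) : List (Gate ℤ ℕ) × Operand ℤ ℕ :=
  (Gate.sum [] :: ((List.range N).map (fun i => Gate.sum [((1 : ℤ), .const (c i))]) ++
    B.map (KGate.toGate (0 + 1))), .gate (useOut N B))

/-- **The evaluation circuit forgets to its twin.** [cite: BlaserIkenmeyerLysikovPandeySchreyer2019, Thm. 40 (proof)] -/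
theorem forgetFin_evalCircuit (N : ℕ) (c : ℕ → ℤ) (B : KBlock) :
    forgetFin (evalCircuit N c B) = evalBodyN N c B := by
  have hl : (List.ofFn fun i : Fin N => layerGate (LayerEntry.const (c i) : LayerEntry (Fin 0))).map
      (Gate.rename Fin.val) = (List.range N).map (fun i => Gate.sum [((1 : ℤ), .const (c i))]) := by
    apply List.ext_getElem
    · simp
    · intro j h₁ h₂
      simp [layerGate, LayerEntry.toOperand, Gate.rename, Operand.rename]
  simp only [forgetFin, evalCircuit, evalBodyN, useGates, List.map_cons, List.map_append, List.map_map,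
    Function.comp_def, rename_toGate, hl]
  rfl

end Twins

/-! ### §4. The writers on codes, under unary budgets -/

section Writers

variable {S : Type} {eS : S → List Bool}

/-- Unary product of two computed unary numerals (via the tree's `unitsMul`; cf.
`QuantumComplexity.unMul_codeFP`, outside this file's import cone). [cite: AroraBarak2009, §1.3] -/
private theorem unMulFP {f g : S → ℕ} (hf : CodeFP eS unE f) (hg : CodeFP eS unE g) :
    CodeFP eS unE (fun s => f s * g s) :=
  ((ulength unitE).comp (unitsMul.comp ((replicateUnit.comp hf).pair (replicateUnit.comp hg)))).congr
    fun p => by simp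

/-- A unary numeral, read in binary. [folklore] -/
private theorem natOfUn' {f : S → ℕ} (h : CodeFP eS unE f) : CodeFP eS natE f := (natOfUn.comp h).congr fun _ => rfl

/-- `nVar k n` in binary from unary `k` and binary `n`. [cite: AroraBarak2009, §1.3] -/
private theorem nVarFP {kf nf : S → ℕ} (hk : CodeFP eS natE kf) (hn : CodeFP eS natE nf) :
    CodeFP eS natE (fun s => nVar (kf s) (nf s)) :=
  (natAdd.comp ((natAdd.comp ((natAdd.comp ((natAdd.comp ((natMul.comp (hk.pair (natPow.comp (hn.pair
    (const _ 2))))).pair hk)).pair hn)).pair hn)).pair hk)).congr fun _ => rfl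

/-- **A coordinate block on codes.** [cite: BlaserIkenmeyerLysikovPandeySchreyer2019, Thm. 40 (proof)] [cite: AroraBarak2009, §1.3] -/
theorem coordBlockNFP {kf nf af jf pf : S → ℕ} (hk : CodeFP eS unE kf) (hn : CodeFP eS natE nf)
    (ha : CodeFP eS natE af) (hj : CodeFP eS natE jf) (hp : CodeFP eS natE pf) :
    CodeFP eS (rawE gateE) (fun s => coordBlockN (kf s) (nf s) (af s) (jf s) (pf s)) := by
  have hkN : CodeFP eS natE kf := natOfUn' hk
  have hM : CodeFP eS natE (fun s => nVar (kf s) (nf s)) := nVarFP hkN hn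
  have hb : CodeFP eS natE (fun s => jf s / nf s % nf s) := natMod.comp ((natDiv.comp (hj.pair hn)).pair hn)
  have hc : CodeFP eS natE (fun s => jf s % nf s) := natMod.comp (hj.pair hn)
  have hKN2 : CodeFP eS natE (fun s => kf s * nf s ^ 2) := natMul.comp (hkN.pair (natPow.comp (hn.pair (const _ 2))))
  have hu : CodeFP eS opE (fun s => varOpN (nVar (kf s) (nf s)) (uIdx (kf s) (nf s) (jf s / nf s % nf s))) :=
    (varOpNFP.comp (hM.pair (natAdd.comp ((natAdd.comp (hKN2.pair hkN)).pair hb)))).congr fun _ => rfl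
  have hv : CodeFP eS opE (fun s => varOpN (nVar (kf s) (nf s)) (vIdx (kf s) (nf s) (jf s % nf s))) :=
    (varOpNFP.comp (hM.pair (natAdd.comp ((natAdd.comp ((natAdd.comp (hKN2.pair hkN)).pair hn)).pair hc)))).congr
      fun _ => rfl
  have hUV : CodeFP eS gateE (fun s => prodUVN (kf s) (nf s) (jf s)) := (gateProd₂FP.comp (hu.pair hv)).congr fun _ => rfl
  -- the `k` products `x_{a'} S_{a' b c}`, context `(s, a')`
  have tk : CodeFP (pairE eS natE) natE (fun t => kf t.1) := hkN.comp (fst _ _)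
  have tn : CodeFP (pairE eS natE) natE (fun t => nf t.1) := hn.comp (fst _ _)
  have ta : CodeFP (pairE eS natE) natE (fun t => t.2) := snd _ _
  have tM : CodeFP (pairE eS natE) natE (fun t => nVar (kf t.1) (nf t.1)) := hM.comp (fst _ _)
  have tb : CodeFP (pairE eS natE) natE (fun t => jf t.1 / nf t.1 % nf t.1) := hb.comp (fst _ _)
  have tc : CodeFP (pairE eS natE) natE (fun t => jf t.1 % nf t.1) := hc.comp (fst _ _)
  have tKN2 : CodeFP (pairE eS natE) natE (fun t => kf t.1 * nf t.1 ^ 2) := hKN2.comp (fst _ _)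
  have tx : CodeFP (pairE eS natE) opE (fun t => varOpN (nVar (kf t.1) (nf t.1)) (xIdx (kf t.1) (nf t.1) t.2)) :=
    (varOpNFP.comp (tM.pair (natAdd.comp (tKN2.pair ta)))).congr fun _ => rfl
  have tS : CodeFP (pairE eS natE) opE (fun t => varOpN (nVar (kf t.1) (nf t.1))
      (t.2 * nf t.1 ^ 2 + jf t.1 / nf t.1 % nf t.1 * nf t.1 + jf t.1 % nf t.1)) :=
    varOpNFP.comp (tM.pair (natAdd.comp ((natAdd.comp ((natMul.comp (ta.pair (natPow.comp (tn.pair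
      (const _ 2))))).pair (natMul.comp (tb.pair tn)))).pair tc)))
  have tXS : CodeFP (pairE eS natE) gateE (fun t => prodXSN (kf t.1) (nf t.1) (jf t.1) t.2) :=
    (gateProd₂FP.comp (tx.pair tS)).congr fun _ => rfl
  have hXS : CodeFP eS (rawE gateE) (fun s => (List.range (kf s)).map (prodXSN (kf s) (nf s) (jf s))) :=
    ((CodeFP.map tXS).comp ((CodeFP.id eS).pair (urange.comp hk))).congr fun _ => rfl
  -- the coordinate gate
  have tcoef : CodeFP (pairE eS natE) (pairE smE opE) (fun t => (if t.2 = af t.1 then (0 : ℤ) else -1, Operand.gate (pf t.1 + 1 + t.2))) :=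
    (((natEq.comp (ta.pair (ha.comp (fst _ _)))).ite (const (pairE eS natE) (0 : ℤ)) (const (pairE eS natE) (-1 : ℤ))).pair
      (opGateFP.comp (natAdd.comp ((natAdd.comp ((hp.comp (fst _ _)).pair (const _ 1))).pair ta)))).congr
      fun t => by simp only [decide_eq_true_eq]
  have hsumArgs : CodeFP eS (rawE (pairE smE opE)) (fun s => ((1 : ℤ), Operand.gate (pf s)) ::
      (List.range (kf s)).map fun a' => (if a' = af s then (0 : ℤ) else -1, Operand.gate (pf s + 1 + a'))) :=
    ((rawCons _).comp ((((const eS (1 : ℤ)).pair (opGateFP.comp hp))).pair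
      ((CodeFP.map tcoef).comp ((CodeFP.id eS).pair (urange.comp hk))))).congr fun _ => rfl
  have hthen : CodeFP eS gateE (fun s => Gate.sum (((1 : ℤ), Operand.gate (pf s)) ::
      (List.range (kf s)).map fun a' => (if a' = af s then (0 : ℤ) else -1, Operand.gate (pf s + 1 + a')))) :=
    gateSumFP.comp hsumArgs
  have helse : CodeFP eS gateE (fun s => Gate.sum [((1 : ℤ), varOpN (nVar (kf s) (nf s)) (jf s))]) :=
    gateCopyFP.comp (varOpNFP.comp (hM.pair hj))
  have hcoord : CodeFP eS gateE (fun s => coordGateN (kf s) (nf s) (af s) (jf s) (pf s)) :=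
    ((natEq.comp ((natDiv.comp (hj.pair (natPow.comp (hn.pair (const _ 2))))).pair ha)).ite hthen helse).congr
      fun s => by simp only [coordGateN, decide_eq_true_eq]
  exact ((rawCons gateE).comp (hUV.pair ((rawAppend gateE).comp (hXS.pair ((rawSingleton gateE).comp hcoord))))).congr
    fun _ => rfl

/-- **The coordinates of a chart on codes** (a `flatMap` over a unary range). [cite: BlaserIkenmeyerLysikovPandeySchreyer2019, Thm. 40 (proof)] [cite: AroraBarak2009, §1.3] -/
theorem coordsNFP {kf nf af bf mf : S → ℕ} (hk : CodeFP eS unE kf) (hn : CodeFP eS natE nf)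
    (ha : CodeFP eS natE af) (hb : CodeFP eS natE bf) (hm : CodeFP eS unE mf) :
    CodeFP eS (rawE gateE) (fun s => coordsN (kf s) (nf s) (af s) (bf s) (mf s)) := by
  have hblk : CodeFP (pairE eS natE) (rawE gateE)
      (fun t => coordBlockN (kf t.1) (nf t.1) (af t.1) t.2 (bf t.1 + t.2 * (kf t.1 + 2))) :=
    coordBlockNFP (hk.comp (fst _ _)) (hn.comp (fst _ _)) (ha.comp (fst _ _)) (snd _ _)
      (natAdd.comp ((hb.comp (fst _ _)).pair (natMul.comp ((snd _ _).pair (natAdd.comp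
        (((natOfUn.comp hk).comp (fst _ _)).pair (const _ 2)))))))
  exact ((flatten gateE).comp ((CodeFP.map hblk).comp ((CodeFP.id eS).pair (urange.comp hm)))).congr
    fun s => by simp [coordsN, List.flatMap_def]

/-- The length of the guessed gate list read off the witness, on codes. [cite: KabanetsImpagliazzo2003, proof of Cor. 12 (p. 358)] -/
theorem blockLengthFP {wit : S → List Bool} (hw : CodeFP eS strE wit) :
    CodeFP eS natE (fun s => (readBlock (wit s)).length) :=
  ((natLength gateE).comp (useBlockFP' (const eS 0) hw)).congr fun _ => by simp

/-- `blockLen k n B` on codes. [cite: AroraBarak2009, §1.3] -/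
private theorem blockLenFP {kf nf : S → ℕ} {wit : S → List Bool} (hk : CodeFP eS natE kf) (hn : CodeFP eS natE nf)
    (hw : CodeFP eS strE wit) :
    CodeFP eS natE (fun s => blockLen (kf s) (nf s) (readBlock (wit s))) := by
  have hN : CodeFP eS natE (fun s => nIn (kf s) (nf s)) := natMul.comp (hk.pair (natPow.comp (hn.pair (const _ 2))))
  exact (natAdd.comp ((natAdd.comp ((natMul.comp (hN.pair (natAdd.comp (hk.pair (const _ 2))))).pair
    (natAdd.comp ((natAdd.comp (hN.pair (blockLengthFP hw))).pair (const _ 1))))).pair (const _ 1))).congr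
    fun _ => rfl

/-- **A chart block on codes**: coordinates, the use behind them, the multiplier gate. [cite: BlaserIkenmeyerLysikovPandeySchreyer2019, Thm. 40 (proof)] [cite: AroraBarak2009, §1.3] -/
theorem chartBlockNFP {kf nf af bf : S → ℕ} {wit : S → List Bool} (hk : CodeFP eS unE kf) (hn : CodeFP eS unE nf)
    (ha : CodeFP eS natE af) (hb : CodeFP eS natE bf) (hw : CodeFP eS strE wit) :
    CodeFP eS (rawE gateE) (fun s => chartBlockN (kf s) (nf s) (readBlock (wit s)) (af s) (bf s)) := by
  have hkN : CodeFP eS natE kf := natOfUn' hk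
  have hnN : CodeFP eS natE nf := natOfUn' hn
  have hNu : CodeFP eS unE (fun s => nIn (kf s) (nf s)) :=
    (unMulFP hk (unMulFP hn hn)).congr fun s => by simp [nIn, pow_two]
  have hNb : CodeFP eS natE (fun s => nIn (kf s) (nf s)) := natOfUn' hNu
  have hco : CodeFP eS (rawE gateE) (fun s => coordsN (kf s) (nf s) (af s) (bf s) (nIn (kf s) (nf s))) :=
    coordsNFP hk hnN ha hb hNu
  have hbase : CodeFP eS natE (fun s => bf s + nIn (kf s) (nf s) * (kf s + 2)) :=
    natAdd.comp (hb.pair (natMul.comp (hNb.pair (natAdd.comp (hkN.pair (const _ 2))))))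
  have hrefs : CodeFP (pairE eS natE) natE (fun t => coordRef (kf t.1) (bf t.1) t.2) :=
    (natAdd.comp ((natAdd.comp ((hb.comp (fst _ _)).pair (natMul.comp ((snd _ _).pair (natAdd.comp
      ((hkN.comp (fst _ _)).pair (const _ 2))))))).pair (natAdd.comp ((hkN.comp (fst _ _)).pair (const _ 1))))).congr
      fun _ => rfl
  have huse : CodeFP eS (rawE gateE) (fun s => (useGatesRef (bf s + nIn (kf s) (nf s) * (kf s + 2))
      (coordRef (kf s) (bf s)) (nIn (kf s) (nf s)) (readBlock (wit s)) : List (Gate ℤ ℕ))) :=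
    (useGatesRefFP hbase hrefs (urange.comp hNu) hw).congr fun _ => rfl
  have hM : CodeFP eS natE (fun s => nVar (kf s) (nf s)) := nVarFP hkN hnN
  have hy : CodeFP eS opE (fun s => varOpN (nVar (kf s) (nf s)) (yIdx (kf s) (nf s) (af s))) :=
    (varOpNFP.comp (hM.pair (natAdd.comp ((natAdd.comp ((natAdd.comp ((natAdd.comp ((natMul.comp (hkN.pair
      (natPow.comp (hnN.pair (const _ 2))))).pair hkN)).pair hnN)).pair hnN)).pair ha)))).congr fun _ => rfl
  have hlast : CodeFP eS gateE (fun s => Gate.prod [varOpN (nVar (kf s) (nf s)) (yIdx (kf s) (nf s) (af s)),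
      Operand.gate (bf s + nIn (kf s) (nf s) * (kf s + 2) + useOut (nIn (kf s) (nf s)) (readBlock (wit s)))]) :=
    (gateProd₂FP.comp (hy.pair (opGateFP.comp (natAdd.comp (hbase.pair (natAdd.comp (hNb.pair
      (blockLengthFP hw)))))))).congr fun _ => rfl
  exact ((rawAppend gateE).comp (((rawAppend gateE).comp (hco.pair huse)).pair ((rawSingleton gateE).comp hlast))).congr
    fun s => by simp [chartBlockN]

/-- **All charts on codes** (a `flatMap` over the unary range of `k`). [cite: BlaserIkenmeyerLysikovPandeySchreyer2019, Thm. 40 (proof)] [cite: AroraBarak2009, §1.3] -/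
theorem chartsNFP {kf nf : S → ℕ} {wit : S → List Bool} (hk : CodeFP eS unE kf) (hn : CodeFP eS unE nf)
    (hw : CodeFP eS strE wit) :
    CodeFP eS (rawE gateE) (fun s => chartsN (kf s) (nf s) (readBlock (wit s)) (kf s)) := by
  have hL : CodeFP eS natE (fun s => blockLen (kf s) (nf s) (readBlock (wit s))) :=
    blockLenFP (natOfUn' hk) (natOfUn' hn) hw
  have hblk : CodeFP (pairE eS natE) (rawE gateE)
      (fun t => chartBlockN (kf t.1) (nf t.1) (readBlock (wit t.1)) t.2 (t.2 * blockLen (kf t.1) (nf t.1) (readBlock (wit t.1)))) :=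
    chartBlockNFP (hk.comp (fst _ _)) (hn.comp (fst _ _)) (snd _ _) (natMul.comp ((snd _ _).pair (hL.comp (fst _ _))))
      (hw.comp (fst _ _))
  exact ((flatten gateE).comp ((CodeFP.map hblk).comp ((CodeFP.id eS).pair (urange.comp hk)))).congr
    fun s => by simp [chartsN, List.flatMap_def]

/-- **The body of the chart-test circuit on codes.** [cite: BlaserIkenmeyerLysikovPandeySchreyer2019, Thm. 40 (proof)] [cite: AroraBarak2009, §1.3] -/
theorem chartBodyNFP {kf nf : S → ℕ} {wit : S → List Bool} (hk : CodeFP eS unE kf) (hn : CodeFP eS unE nf)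
    (hw : CodeFP eS strE wit) :
    CodeFP eS circE (fun s => chartBodyN (kf s) (nf s) (readBlock (wit s))) := by
  have hkN : CodeFP eS natE kf := natOfUn' hk
  have hnN : CodeFP eS natE nf := natOfUn' hn
  have hL : CodeFP eS natE (fun s => blockLen (kf s) (nf s) (readBlock (wit s))) := blockLenFP hkN hnN hw
  have hfin : CodeFP eS gateE (fun s => finalGateN (kf s) (nf s) (readBlock (wit s))) := by
    have targ : CodeFP (pairE eS natE) (pairE smE opE) (fun t => ((1 : ℤ),
        Operand.gate (t.2 * blockLen (kf t.1) (nf t.1) (readBlock (wit t.1)) +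
          (blockLen (kf t.1) (nf t.1) (readBlock (wit t.1)) - 1)))) :=
      (const _ (1 : ℤ)).pair (opGateFP.comp (natAdd.comp ((natMul.comp ((snd _ _).pair (hL.comp (fst _ _)))).pair
        (natSub.comp ((hL.comp (fst _ _)).pair (const _ 1))))))
    exact (gateSumFP.comp ((CodeFP.map targ).comp ((CodeFP.id eS).pair (urange.comp hk)))).congr fun _ => rfl
  have hMu : CodeFP eS unE (fun s => nVar (kf s) (nf s)) :=
    (unAdd.comp ((unAdd.comp ((unAdd.comp ((unAdd.comp ((unMulFP hk (unMulFP hn hn)).pair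
      hk)).pair hn)).pair hn)).pair hk)).congr fun s => by simp [nVar, pow_two]
  have hbal : CodeFP eS (rawE gateE) (fun s => List.replicate (nVar (kf s) (nf s)) (Gate.sum [])) :=
    ((CodeFP.map (const (pairE eS natE) (Gate.sum ([] : List (ℤ × Operand ℤ ℕ))))).comp
      ((CodeFP.id eS).pair (urange.comp hMu))).congr fun s => by simp [List.map_const']
  have hgates : CodeFP eS (listE gateE) (fun s => chartsN (kf s) (nf s) (readBlock (wit s)) (kf s) ++
      [finalGateN (kf s) (nf s) (readBlock (wit s))] ++ List.replicate (nVar (kf s) (nf s)) (Gate.sum [])) :=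
    ((listOfRaw gateE).comp ((rawAppend gateE).comp (((rawAppend gateE).comp ((chartsNFP hk hn hw).pair
      ((rawSingleton gateE).comp hfin))).pair hbal))).congr fun _ => rfl
  have hout : CodeFP eS opE (fun s => Operand.gate (kf s * blockLen (kf s) (nf s) (readBlock (wit s)))) :=
    opGateFP.comp (natMul.comp (hkN.pair hL))
  exact (hgates.pair hout).congr fun _ => rfl

/-- **The padded tensor entry on codes.** [cite: BlaserIkenmeyerLysikovPandeySchreyer2019, Lemma 16 (padding)] [cite: AroraBarak2009, §1.3] -/
theorem padEntryFP (n₀ : ℕ) {nf : S → ℕ} {lf : S → List ℤ} (hn : CodeFP eS natE nf) (hl : CodeFP eS (rawE smE) lf) :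
    CodeFP (pairE eS natE) smE (fun t => padEntry (nf t.1) n₀ (lf t.1) t.2) := by
  have tn : CodeFP (pairE eS natE) natE (fun t => nf t.1) := hn.comp (fst _ _)
  have tn' : CodeFP (pairE eS natE) natE (fun t => nf t.1 + n₀) := natAdd.comp (tn.pair (const _ n₀))
  have ti : CodeFP (pairE eS natE) natE (fun t => t.2) := snd _ _
  have ta : CodeFP (pairE eS natE) natE (fun t => t.2 / (nf t.1 + n₀) ^ 2) := natDiv.comp (ti.pair (natPow.comp (tn'.pair (const _ 2))))
  have tb : CodeFP (pairE eS natE) natE (fun t => t.2 / (nf t.1 + n₀) % (nf t.1 + n₀)) := natMod.comp ((natDiv.comp (ti.pair tn')).pair tn')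
  have tc : CodeFP (pairE eS natE) natE (fun t => t.2 % (nf t.1 + n₀)) := natMod.comp (ti.pair tn')
  have tcond : CodeFP (pairE eS natE) bitE (fun t => decide (t.2 / (nf t.1 + n₀) % (nf t.1 + n₀) < nf t.1) &&
      decide (t.2 % (nf t.1 + n₀) < nf t.1)) := (natLt.comp (tb.pair tn)).and (natLt.comp (tc.pair tn))
  have tidx : CodeFP (pairE eS natE) natE (fun t => t.2 / (nf t.1 + n₀) ^ 2 * nf t.1 ^ 2 +
      t.2 / (nf t.1 + n₀) % (nf t.1 + n₀) * nf t.1 + t.2 % (nf t.1 + n₀)) :=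
    natAdd.comp ((natAdd.comp ((natMul.comp (ta.pair (natPow.comp (tn.pair (const _ 2))))).pair
      (natMul.comp (tb.pair tn)))).pair tc)
  have tl : CodeFP (pairE eS natE) (rawE smE) (fun t => lf t.1) := hl.comp (fst _ _)
  have tz : CodeFP (pairE eS natE) smE (fun _ => (0 : ℤ)) := const _ (0 : ℤ)
  have tget : CodeFP (pairE eS natE) smE (fun t => (lf t.1).getD (t.2 / (nf t.1 + n₀) ^ 2 * nf t.1 ^ 2 +
      t.2 / (nf t.1 + n₀) % (nf t.1 + n₀) * nf t.1 + t.2 % (nf t.1 + n₀)) 0) :=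
    ((rawGetOr smE).comp (tl.pair (tidx.pair tz))).congr fun _ => rfl
  refine (tcond.ite tget tz).congr fun t => ?_
  unfold padEntry
  by_cases h : t.2 / (nf t.1 + n₀) % (nf t.1 + n₀) < nf t.1 ∧ t.2 % (nf t.1 + n₀) < nf t.1
  · rw [if_pos h, if_pos (by simp [h])]
  · rw [if_neg h, if_neg (by simpa [Bool.and_eq_true, decide_eq_true_eq] using h)]

/-- **The body of the evaluation circuit on codes.** [cite: BlaserIkenmeyerLysikovPandeySchreyer2019, Thm. 40 (proof)] [cite: AroraBarak2009, §1.3] -/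
theorem evalBodyNFP (n₀ : ℕ) {kf nf : S → ℕ} {lf : S → List ℤ} {wit : S → List Bool} (hk : CodeFP eS unE kf)
    (hn : CodeFP eS unE nf) (hl : CodeFP eS (rawE smE) lf) (hw : CodeFP eS strE wit) :
    CodeFP eS circE (fun s => evalBodyN (nIn (kf s) (nf s + n₀)) (padEntry (nf s) n₀ (lf s)) (readBlock (wit s))) := by
  have hnN : CodeFP eS natE nf := natOfUn' hn
  have hn'u : CodeFP eS unE (fun s => nf s + n₀) := unAdd.comp (hn.pair (const _ n₀))
  have hNu : CodeFP eS unE (fun s => nIn (kf s) (nf s + n₀)) :=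
    (unMulFP hk (unMulFP hn'u hn'u)).congr fun s => by simp [nIn, pow_two]
  have hlayer : CodeFP (pairE eS natE) gateE (fun t => Gate.sum [((1 : ℤ), Operand.const (padEntry (nf t.1) n₀ (lf t.1) t.2))]) :=
    gateSumFP.comp ((rawSingleton _).comp (((const _ (1 : ℤ)).pair (opConstFP.comp (padEntryFP n₀ hnN hl))).congr
      fun _ => rfl))
  have hgates : CodeFP eS (listE gateE) (fun s => Gate.sum [] ::
      ((List.range (nIn (kf s) (nf s + n₀))).map (fun i => Gate.sum [((1 : ℤ), Operand.const (padEntry (nf s) n₀ (lf s) i))]) ++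
        (readBlock (wit s)).map (KGate.toGate (0 + 1)))) :=
    ((listOfRaw gateE).comp ((rawCons gateE).comp ((const _ (Gate.sum [])).pair ((rawAppend gateE).comp
      (((CodeFP.map hlayer).comp ((CodeFP.id eS).pair (urange.comp hNu))).pair (useBlockFP' (const eS 0) hw)))))).congr
      fun _ => rfl
  have hout : CodeFP eS opE (fun s => Operand.gate (useOut (nIn (kf s) (nf s + n₀)) (readBlock (wit s)))) :=
    opGateFP.comp (natAdd.comp ((natOfUn' hNu).pair (blockLengthFP hw)))
  exact (hgates.pair hout).congr fun _ => rfl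

end Writers

/-! ### §5. The writers on an (instance, witness) pair, and the string functions -/

section Instance

/-- The verifier's context: an `HMinRank1` instance `(n, k, entries, r)` and a witness string. [cite: BlaserIkenmeyerLysikovPandeySchreyer2019, Thm. 40 (proof)] -/
abbrev Ctx : Type := (ℕ × ℕ × List ℤ × ℕ) × List Bool

/-- Code of a context: the instance code paired with the witness. [cite: AroraBarak2009, §0.1] -/
abbrev ctxE : Ctx → List Bool := pairE instE strE

/-- `n` capped by the length of the entry list (equal to `n` under the guard). [cite: AroraBarak2009, §1.3 (bounded loops)] -/
def capN (s : Ctx) : ℕ := min s.1.1 s.1.2.2.1.length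

/-- `k` capped by the length of the entry list (equal to `k` under the guard). [cite: AroraBarak2009, §1.3 (bounded loops)] -/
def capK (s : Ctx) : ℕ := min s.1.2.1 s.1.2.2.1.length

/-- **The guard** of the verifier: `|entries| = k n²`, `r = 1`, `1 ≤ n`, `1 ≤ k` (then `n, k ≤ |entries|`).
[cite: BlaserIkenmeyerLysikovPandeySchreyer2019, Problem 2 (input)] -/
def guard (x : ℕ × ℕ × List ℤ × ℕ) : Bool :=
  decide (x.2.2.1.length = x.2.1 * x.1 ^ 2) && decide (x.2.2.2 = 1) && decide (1 ≤ x.1) && decide (1 ≤ x.2.1)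

/-- **The easy cases** decided without a witness: ill-formed entry list, `r ≠ 1`, or no slices
(`k = 0`, where `𝓜_1 = ∅`). [cite: BlaserIkenmeyerLysikovPandeySchreyer2019, Problem 2 (input) and Def. 15] -/
def easy (x : ℕ × ℕ × List ℤ × ℕ) : Bool :=
  !(decide (x.2.2.1.length = x.2.1 * x.1 ^ 2) && decide (x.2.2.2 = 1)) || decide (x.2.1 = 0)

/-- Under the guard the caps are exact. [cite: AroraBarak2009, §1.3 (bounded loops)] -/
theorem capN_eq {s : Ctx} (h : guard s.1 = true) : capN s = s.1.1 := by
  obtain ⟨⟨n, k, l, r⟩, y⟩ := s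
  simp only [guard, Bool.and_eq_true, decide_eq_true_eq] at h
  obtain ⟨⟨⟨hl, -⟩, hn⟩, hk⟩ := h
  simp only [capN]
  refine min_eq_left ?_
  rw [hl]
  calc n ≤ n ^ 2 := by rw [pow_two]; exact Nat.le_mul_of_pos_left n hn
    _ ≤ k * n ^ 2 := Nat.le_mul_of_pos_left _ hk

/-- Under the guard the caps are exact. [cite: AroraBarak2009, §1.3 (bounded loops)] -/
theorem capK_eq {s : Ctx} (h : guard s.1 = true) : capK s = s.1.2.1 := by
  obtain ⟨⟨n, k, l, r⟩, y⟩ := s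
  simp only [guard, Bool.and_eq_true, decide_eq_true_eq] at h
  obtain ⟨⟨⟨hl, -⟩, hn⟩, -⟩ := h
  simp only [capK]
  refine min_eq_left ?_
  rw [hl]
  exact Nat.le_mul_of_pos_right k (pow_pos hn 2)

/-- **The chart-test word of a context** (capped parameters, padding constant `n₀`): the code word of
the chart-test circuit of the guessed block, in `M = nVar k (n + n₀)` variables.
[cite: BlaserIkenmeyerLysikovPandeySchreyer2019, Thm. 40 (proof)] -/
def chartInst (n₀ : ℕ) (s : Ctx) : ℕ × (List (Gate ℤ ℕ) × Operand ℤ ℕ) :=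
  (nVar (capK s) (capN s + n₀), chartBodyN (capK s) (capN s + n₀) (readBlock s.2))

/-- **The evaluation word of a context**: the code word of the evaluation circuit of the guessed
block at the zero-padded instance tensor (no variables). [cite: BlaserIkenmeyerLysikovPandeySchreyer2019, Thm. 40 (proof)] -/
def evalInst (n₀ : ℕ) (s : Ctx) : ℕ × (List (Gate ℤ ℕ) × Operand ℤ ℕ) :=
  (0, evalBodyN (nIn (capK s) (capN s + n₀)) (padEntry (capN s) n₀ s.1.2.2.1) (readBlock s.2))

/-- **Under the guard the chart-test word is the code word of `chartCircuit`.** [cite: BlaserIkenmeyerLysikovPandeySchreyer2019, Thm. 40 (proof)] -/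
theorem wordE_chartInst {n₀ : ℕ} {s : Ctx} (h : guard s.1 = true) :
    wordE (chartInst n₀ s) = circuitWord (nVar s.1.2.1 (s.1.1 + n₀)) (chartCircuit s.1.2.1 (s.1.1 + n₀) (readBlock s.2)) := by
  rw [circuitWord_eq_wordE, forgetFin_chartCircuit, chartInst, capN_eq h, capK_eq h]

/-- **Under the guard the evaluation word is the code word of `evalCircuit`.** [cite: BlaserIkenmeyerLysikovPandeySchreyer2019, Thm. 40 (proof)] -/
theorem wordE_evalInst {n₀ : ℕ} {s : Ctx} (h : guard s.1 = true) :
    wordE (evalInst n₀ s) =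
      circuitWord 0 (evalCircuit (nIn s.1.2.1 (s.1.1 + n₀)) (padEntry s.1.1 n₀ s.1.2.2.1) (readBlock s.2)) := by
  rw [circuitWord_eq_wordE, forgetFin_evalCircuit, evalInst, capN_eq h, capK_eq h]

/-- The entry list as a raw list, on codes. [folklore] -/
private theorem entriesFP : CodeFP ctxE (rawE smE) (fun s : Ctx => s.1.2.2.1) :=
  ((rawOfList smE).comp (fst _ _).snd'.snd'.fst').congr fun _ => rfl

/-- The capped `n` in unary, on codes. [cite: AroraBarak2009, §1.3] -/
private theorem capNFP : CodeFP ctxE unE capN :=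
  (unOfNatMin.comp (((ulength smE).comp entriesFP).pair (fst _ _).fst')).congr fun _ => rfl

/-- The capped `k` in unary, on codes. [cite: AroraBarak2009, §1.3] -/
private theorem capKFP : CodeFP ctxE unE capK :=
  (unOfNatMin.comp (((ulength smE).comp entriesFP).pair (fst _ _).snd'.fst')).congr fun _ => rfl

/-- **The chart-test word is written in polynomial time.** [cite: BlaserIkenmeyerLysikovPandeySchreyer2019, Thm. 40 (proof)] [cite: AroraBarak2009, §1.3] -/
theorem chartInstFP (n₀ : ℕ) : CodeFP ctxE wordE (chartInst n₀) := by
  have hn' : CodeFP ctxE unE (fun s => capN s + n₀) := unAdd.comp (capNFP.pair (const _ n₀))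
  have hM : CodeFP ctxE natE (fun s => nVar (capK s) (capN s + n₀)) :=
    (natAdd.comp ((natAdd.comp ((natAdd.comp ((natAdd.comp ((natMul.comp ((natOfUn.comp capKFP).pair
      (natPow.comp ((natOfUn.comp hn').pair (const _ 2))))).pair (natOfUn.comp capKFP))).pair
      (natOfUn.comp hn'))).pair (natOfUn.comp hn'))).pair (natOfUn.comp capKFP))).congr fun _ => rfl
  exact (hM.pair (chartBodyNFP capKFP hn' (snd _ _))).congr fun _ => rfl

/-- **The evaluation word is written in polynomial time.** [cite: BlaserIkenmeyerLysikovPandeySchreyer2019, Thm. 40 (proof)] [cite: AroraBarak2009, §1.3] -/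
theorem evalInstFP (n₀ : ℕ) : CodeFP ctxE wordE (evalInst n₀) :=
  ((const _ 0).pair (evalBodyNFP n₀ capKFP capNFP entriesFP (snd _ _))).congr fun _ => rfl

/-- **The guard is decided in polynomial time.** [cite: AroraBarak2009, §1.3] -/
theorem guardFP : CodeFP instE bitE guard := by
  have hn : CodeFP instE natE (fun x => x.1) := fst _ _
  have hk : CodeFP instE natE (fun x => x.2.1) := (snd _ _).fst'
  have hl : CodeFP instE (rawE smE) (fun x => x.2.2.1) := ((rawOfList smE).comp (snd _ _).snd'.fst').congr fun _ => rfl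
  have hr : CodeFP instE natE (fun x => x.2.2.2) := (snd _ _).snd'.snd'
  exact (((natEq.comp (((natLength smE).comp hl).pair (natMul.comp (hk.pair (natPow.comp (hn.pair (const _ 2))))))).and
    (natEq.comp (hr.pair (const _ 1)))).and (natLe.comp ((const _ 1).pair hn))).and (natLe.comp ((const _ 1).pair hk))

/-- **The easy cases are decided in polynomial time.** [cite: AroraBarak2009, §1.3] -/
theorem easyFP : CodeFP instE bitE easy := by
  have hn : CodeFP instE natE (fun x => x.1) := fst _ _
  have hk : CodeFP instE natE (fun x => x.2.1) := (snd _ _).fst'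
  have hl : CodeFP instE (rawE smE) (fun x => x.2.2.1) := ((rawOfList smE).comp (snd _ _).snd'.fst').congr fun _ => rfl
  have hr : CodeFP instE natE (fun x => x.2.2.2) := (snd _ _).snd'.snd'
  exact ((natEq.comp (((natLength smE).comp hl).pair (natMul.comp (hk.pair (natPow.comp (hn.pair (const _ 2))))))).and
    (natEq.comp (hr.pair (const _ 1)))).not.or (natEq.comp (hk.pair (const _ 0)))

/-! #### On the full input word `⟨w, y⟩` (`w` arbitrary, decoded by `decT`) -/

/-- The context read off an input pair `(w, y)`: decode the instance, keep the witness. [cite: AroraBarak2009, §0.1] -/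
def ctxOf (p : List Bool × List Bool) : Ctx := (decT p.1, p.2)

/-- `ctxOf` on codes (the re-encoding of `decT` is polynomial time). [cite: AroraBarak2009, §1.3] -/
theorem ctxOfFP : CodeFP (pairE strE strE) ctxE ctxOf := (decT_codeFP.comp (fst _ _)).pair (snd _ _)

/-- **The input word is a canonical instance code** (`instE (decT w) = w`), on codes. [cite: AroraBarak2009, §0.1] -/
theorem canonFP : CodeFP (pairE strE strE) bitE (fun p => decide (instE (decT p.1) = p.1)) := by
  have hre : CodeFP strE strE (fun w => instE (decT w)) := decT_codeFP.recodeOut fun _ => rfl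
  have hre' : CodeFP (pairE strE strE) strE (fun p => instE (decT p.1)) := hre.comp (fst _ _)
  exact ((CodeFP.eq (eα := strE) fun _ _ h => h).comp (hre'.pair (fst _ _))).congr fun _ => rfl

/-- **The chart-test word of an input pair**, as a polynomial-time string function: some `f ∈ FP` has
`f ⟨w, y⟩ = wordE (chartInst n₀ (decT w, y))`. [cite: BlaserIkenmeyerLysikovPandeySchreyer2019, Thm. 40 (proof)] -/
theorem exists_chartFn (n₀ : ℕ) :
    ∃ f ∈ FP, ∀ w y : List Bool, f (boolPair w y) = wordE (chartInst n₀ (decT w, y)) := by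
  obtain ⟨f, hf, hfw⟩ := (chartInstFP n₀).comp ctxOfFP
  exact ⟨f, hf, fun w y => hfw (w, y)⟩

/-- **The evaluation word of an input pair**, as a polynomial-time string function.
[cite: BlaserIkenmeyerLysikovPandeySchreyer2019, Thm. 40 (proof)] -/
theorem exists_evalFn (n₀ : ℕ) :
    ∃ f ∈ FP, ∀ w y : List Bool, f (boolPair w y) = wordE (evalInst n₀ (decT w, y)) := by
  obtain ⟨f, hf, hfw⟩ := (evalInstFP n₀).comp ctxOfFP
  exact ⟨f, hf, fun w y => hfw (w, y)⟩

/-- **The main-case test of an input pair** (canonical code and guard), as a polynomial-time one-bit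
string function. [cite: AroraBarak2009, §1.3] -/
theorem exists_mainFn :
    ∃ f ∈ FP, ∀ w y : List Bool, f (boolPair w y) = [decide (instE (decT w) = w) && guard (decT w)] := by
  obtain ⟨f, hf, hfw⟩ := canonFP.and (guardFP.comp (ctxOfFP.fst'))
  exact ⟨f, hf, fun w y => hfw (w, y)⟩

/-- **The easy-accept test of an input pair** (non-canonical code, or an easy instance), as a
polynomial-time one-bit string function. [cite: AroraBarak2009, §1.3] -/
theorem exists_easyFn :
    ∃ f ∈ FP, ∀ w y : List Bool, f (boolPair w y) = [!decide (instE (decT w) = w) || easy (decT w)] := by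
  obtain ⟨f, hf, hfw⟩ := canonFP.not.or (easyFP.comp (ctxOfFP.fst'))
  exact ⟨f, hf, fun w y => hfw (w, y)⟩

end Instance

end BILPS2019Cor42

end Literature.Barriers.ValiantsHypothesis
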